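import Mathlib.RingTheory.RootsOfUnity.Complex
import Mathlib.FieldTheory.IntermediateField.Adjoin.Basic
import Literature.NumberTheory.Transcendental.ZilberField
import HarnessLib

/-!
# The algebraic numbers definable in Zilber fields (Kirby–Macintyre–Onshuus 2012)

J. Kirby, A. Macintyre, A. Onshuus, *The algebraic numbers definable in various exponential
fields*, J. Inst. Math. Jussieu 11 (2012) 825–834 (arXiv:1101.4224), §§2.1, 3.1–3.8.

In an exponential field `F` whose kernel `ker exp` is infinite cyclic, with generators `±τ`, the
roots of unity are the `exp (jτ/n)`, so `F ⊇ ℚ^{ab} = ℚ(U)`; the *real abelian numbers* `ℚ^{abℝ}`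
are the fixed field of the involution `σ₀` of `ℚ^{ab}` inverting the roots of unity (§2.1), i.e.
the union of the maximal real subfields `ℚ(ζ + ζ⁻¹)` of the cyclotomic fields `ℚ(ζ)`. KMO prove:
every real abelian number is pointwise definable in every such `F` (Theorem 1), and in a *Zilber
field* nothing else among the algebraic numbers is (Theorem 2). The proof of Theorem 2 (§3.7) is an
automorphism argument resting on the "key structural property of Zilber fields" (§3.5,
Proposition: automorphisms of finitely generated strongly embedded partial exponential subfields
containing `SK = ℚ^{ab}(τ)` extend to the whole field), and §3.8 records its outcome: *in a Zilber
field with the countable closure property, an algebraic number is real abelian iff its orbit under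
automorphisms of the field is a singleton.*

## Contents

* `Literature.ModelTheory.ExponentialFields.IsRealAbelian x` — `x ∈ ℚ(ζ + ζ⁻¹)` for some root of
  unity `ζ` of the ambient field (KMO §2.1, `ℚ^{abℝ}`), with the API `IsRealAbelian.ratCast`,
  `IsRealAbelian.add_inv`, `IsRealAbelian.isAlgebraic`, and for `F = ℂ` the proved description
  `IsRealAbelian.complex : x.im = 0 ∧ ∃ n > 0, x ∈ ℚ(exp (2πi/n))`.
* PROVED (the automorphism shadow of Theorem 1, elementary): every automorphism of an exponential
  field with standard kernel and surjective exponential maps `τ ↦ ±τ`, every root of unity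
  `ζ ↦ ζ^{±1}`, and fixes every real abelian number
  (`equiv_apply_eq_or_eq_neg_of_expKernel_eq`, `equiv_apply_eq_or_eq_inv_of_pow_eq_one`,
  `equiv_apply_eq_of_isRealAbelian`).
* NAMED FACT `KMO2012_automorphismExtension` — §3.5, Proposition (extending automorphisms), as
  printed, over `Literature.NumberTheory.Transcendental.IsZilberField` (KMO's "Zilber field with
  CCP"), with KMO's partial exponential subfields (§3.1) and strong embeddings `F₀ ◁ F` (§3.2)
  rendered inline.
* NAMED FACT `KMO2012_exists_equiv_apply_ne` — §3.7 (proof of Theorem 2, automorphism form): in a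
  Zilber field with CCP every algebraic number which is not real abelian is moved by some
  automorphism of the exponential field.
* PROVED from the latter: §3.8 as printed (`KMO2012_exists_equiv_apply_ne.forall_equiv_apply_eq_iff`:
  singleton orbit iff real abelian), the form with `a ↦ ±a` excluded when `a²` is not real abelian
  (`….exists_equiv_apply_ne_and_ne_neg`), and its specialisation to `ℂ_exp` under Zilber's
  conjecture `IsZilberField ℂ` with the real-abelian condition spelled out in `ℂ`
  (`….complex`), which is the transfer "Zilber's conjecture ⇒ prescribed Galois orbits are realised
  by automorphisms of `ℂ_exp`" asked for by the Schanuel routes.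

## What is NOT here

* Theorem 2 itself (pointwise `∅`-definability in the language of exponential rings): it follows
  from `KMO2012_exists_equiv_apply_ne` for fields with CCP because automorphisms preserve definable
  sets, and in general through KMO's Löwenheim–Skolem Lemma 3.6; neither the definability
  statement nor Lemma 3.6 is vendored. Theorem 1 (definability of the real abelian numbers) is not
  vendored either; only its automorphism-invariance shadow is proved here.
* The description "`Aut(F)` restricted to `ℚ̄` is `{σ ∈ Gal(ℚ̄/ℚ) : σ|ℚ^{ab} ∈ {1, σ₀}}`" used
  informally by the Schanuel route texts is *not printed* in KMO (§3.7 constructs one extension of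
  `σ₁ : τ ↦ -τ` and, for `α ∉ ℚ^{ab}`, one automorphism over `SK` moving `α`) and is not vendored.
* "Theorem 2 for `ℂ_exp`" is OPEN (KMO p. 2: "we have not been able to prove it even assuming
  Schanuel's Conjecture"); nothing here asserts anything about `ℂ` unconditionally beyond the
  description of `IsRealAbelian` in `ℂ`.

## Design choices

* `IsRealAbelian` is defined in any field of characteristic zero by `x ∈ ℚ(ζ + ζ⁻¹)` for some root
  of unity `ζ` of the field, rather than as `Fix(σ₀)`: in an abstract field there is no preferred
  `σ₀` to name, and by the Galois theory of cyclotomic fields (`ℚ(ζₙ)^{⟨ζ ↦ ζ⁻¹⟩} = ℚ(ζₙ + ζₙ⁻¹)`,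
  the maximal real subfield; KMO §2.1 last paragraph and §2.7: "every element in `ℚ^{abℝ}` is a
  rational combination of special values of the cosine function") the two agree:
  `Fix(σ₀) = ⋃ₙ ℚ(ζₙ + ζₙ⁻¹)`. For `ℂ` the proved lemma `IsRealAbelian.complex` gives the inclusion
  `ℚ^{abℝ} ⊆ ℚ^{ab} ∩ ℝ` in the form the Schanuel route files use inline.
* Both named facts quantify over fields `F : Type u` in an arbitrary universe (use `.{0}` for `ℂ`).
* KMO's "Zilber field" omits CCP from the axioms and both vendored statements are printed for
  "a Zilber field with CCP"; the tree's `IsZilberField` includes CCP (and asks the kernel generator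
  to be transcendental, which in KMO follows from the Schanuel condition), so the hypothesis
  `IsZilberField F` is the printed one.

## References

* J. Kirby, A. Macintyre, A. Onshuus, *The algebraic numbers definable in various exponential
  fields*, J. Inst. Math. Jussieu 11 (2012) 825–834, arXiv:1101.4224: §2.1 (`ℚ^{abℝ}`), §3.1
  (partial exponential fields, `SK`), §3.2 (strong embeddings), §3.5 Proposition, §3.7 (proof of
  Theorem 2), §3.8 (orbits).
* J. Kirby, *Finitely presented exponential fields*, Algebra & Number Theory 7 (2013) 943–980
  (the countable case of the Proposition, cited by KMO as [K1]).
* J. Kirby, *On quasiminimal excellent classes*, J. Symbolic Logic 75 (2010) 551–564, Thm 3.3.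
-/

noncomputable section

universe u

namespace Literature.ModelTheory.ExponentialFields

open Literature.NumberTheory.Transcendental

/-! ### Real abelian numbers (KMO §2.1) -/

section RealAbelian

variable {F : Type*} [Field F] [CharZero F]

/-- **Real abelian numbers** (Kirby–Macintyre–Onshuus 2012, §2.1, `ℚ^{abℝ}`). An element `x` of
a field of characteristic zero is *real abelian* if it lies in `ℚ(ζ + ζ⁻¹)` for some root of
unity `ζ` of the field, i.e. in the maximal real subfield of some cyclotomic field `ℚ(ζ) ⊆ F`.
KMO define `ℚ^{abℝ}` as the fixed field of the involution `σ₀` of `ℚ^{ab} = ℚ(U)` with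
`σ₀(ζ) = ζ⁻¹` on the roots of unity `U`; since `ℚ(ζ)^{⟨σ₀⟩} = ℚ(ζ + ζ⁻¹)` for every root of unity
`ζ`, `Fix(σ₀) = ⋃_ζ ℚ(ζ + ζ⁻¹)`, which is the present definition (it names no automorphism of the
ambient field). Equivalently (loc. cit.): the unique maximal formally real subfield of `ℚ^{ab}`;
`ℚ^{ab} ∩ ℚ^{tr}`; in `ℂ`, `ℚ^{ab} ∩ ℝ` (see `IsRealAbelian.complex`).
[cite: KirbyMacintyreOnshuus2012, §2.1] -/
def IsRealAbelian (x : F) : Prop :=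
  ∃ ζ : F, (∃ n : ℕ, 0 < n ∧ ζ ^ n = 1) ∧ x ∈ IntermediateField.adjoin ℚ ({ζ + ζ⁻¹} : Set F)

/-- Unfolding lemma for `IsRealAbelian`. [cite: KirbyMacintyreOnshuus2012, §2.1] -/
theorem isRealAbelian_iff (x : F) :
    IsRealAbelian x ↔
      ∃ ζ : F, (∃ n : ℕ, 0 < n ∧ ζ ^ n = 1) ∧ x ∈ IntermediateField.adjoin ℚ ({ζ + ζ⁻¹} : Set F) :=
  Iff.rfl

/-- `ζ + ζ⁻¹ = 2 cos (2πj/n)` is real abelian for every root of unity `ζ` (KMO §2.1, §2.7).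
[cite: KirbyMacintyreOnshuus2012, §2.1] -/
theorem IsRealAbelian.add_inv {ζ : F} {n : ℕ} (hn : 0 < n) (hζ : ζ ^ n = 1) :
    IsRealAbelian (ζ + ζ⁻¹) :=
  ⟨ζ, ⟨n, hn, hζ⟩, IntermediateField.mem_adjoin_simple_self ℚ _⟩

/-- Rational numbers are real abelian. [folklore] -/
theorem IsRealAbelian.ratCast (q : ℚ) : IsRealAbelian (q : F) := by
  refine ⟨1, ⟨1, one_pos, one_pow 1⟩, ?_⟩
  have h := (IntermediateField.adjoin ℚ ({(1 : F) + 1⁻¹} : Set F)).algebraMap_mem q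
  rwa [eq_ratCast] at h

/-- Real abelian numbers are algebraic over `ℚ` (they lie in a cyclotomic field). [folklore] -/
theorem IsRealAbelian.isAlgebraic {x : F} (hx : IsRealAbelian x) : IsAlgebraic ℚ x := by
  obtain ⟨ζ, ⟨n, hn, hζ⟩, hmem⟩ := hx
  have hζi : IsIntegral ℚ ζ := IsIntegral.of_pow hn (by rw [hζ]; exact isIntegral_one)
  have hg : IsIntegral ℚ (ζ + ζ⁻¹) := hζi.add hζi.inv
  haveI := IntermediateField.adjoin.finiteDimensional hg
  have halg : IsAlgebraic ℚ (⟨x, hmem⟩ : IntermediateField.adjoin ℚ ({ζ + ζ⁻¹} : Set F)) :=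
    Algebra.IsAlgebraic.isAlgebraic _
  exact IntermediateField.isAlgebraic_iff.1 halg

/-- The fixed points of a ring endomorphism of a field of characteristic zero form a subfield
containing `ℚ`. [folklore] -/
def ringHomFixedField (σ : F →+* F) : IntermediateField ℚ F where
  carrier := {x | σ x = x}
  mul_mem' {a b} ha hb := by
    simp only [Set.mem_setOf_eq] at ha hb ⊢
    rw [map_mul, ha, hb]
  one_mem' := map_one σ
  add_mem' {a b} ha hb := by
    simp only [Set.mem_setOf_eq] at ha hb ⊢
    rw [map_add, ha, hb]
  zero_mem' := map_zero σ
  algebraMap_mem' q := by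
    simp only [Set.mem_setOf_eq, eq_ratCast, map_ratCast]
  inv_mem' a ha := by
    simp only [Set.mem_setOf_eq] at ha ⊢
    rw [map_inv₀, ha]

/-- Membership in `ringHomFixedField`. [folklore] -/
@[simp] theorem mem_ringHomFixedField_iff (σ : F →+* F) (x : F) :
    x ∈ ringHomFixedField σ ↔ σ x = x :=
  Iff.rfl

/-- A ring endomorphism fixing `ζ + ζ⁻¹` fixes `ℚ(ζ + ζ⁻¹)` pointwise. [folklore] -/
theorem ringHom_apply_eq_of_mem_adjoin (σ : F →+* F) {g x : F} (hg : σ g = g)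
    (hx : x ∈ IntermediateField.adjoin ℚ ({g} : Set F)) : σ x = x := by
  have hle : IntermediateField.adjoin ℚ ({g} : Set F) ≤ ringHomFixedField σ :=
    IntermediateField.adjoin_le_iff.2 (Set.singleton_subset_iff.2 hg)
  exact hle hx

/-- **Real abelian numbers of `ℂ` are real and cyclotomic** (KMO §2.1: in `ℂ`,
`ℚ^{abℝ} ⊆ ℚ^{ab} ∩ ℝ`): if `x ∈ ℚ(ζ + ζ⁻¹)` with `ζⁿ = 1`, then `x` is real and lies in
`ℚ(e^{2πi/n})`. This is the inline rendering of "real abelian" used by the Schanuel route files.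
[cite: KirbyMacintyreOnshuus2012, §2.1] -/
theorem IsRealAbelian.complex {x : ℂ} (hx : IsRealAbelian x) :
    x.im = 0 ∧ ∃ n : ℕ, 0 < n ∧
      x ∈ IntermediateField.adjoin ℚ ({Complex.exp (2 * Real.pi * Complex.I / n)} : Set ℂ) := by
  obtain ⟨ζ, ⟨n, hn, hζ⟩, hmem⟩ := hx
  have hn0 : n ≠ 0 := hn.ne'
  -- `ζ⁻¹ = conj ζ` since `‖ζ‖ = 1`
  have hnorm : ‖ζ‖ = 1 := Complex.norm_eq_one_of_pow_eq_one hζ hn0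
  have hζ0 : ζ ≠ 0 := fun h => by simp [h] at hnorm
  have hinv : ζ⁻¹ = (starRingEnd ℂ) ζ := by
    have hmul : ζ * (starRingEnd ℂ) ζ = 1 := by
      rw [Complex.mul_conj, Complex.normSq_eq_norm_sq, hnorm]; simp
    exact (eq_inv_of_mul_eq_one_right hmul).symm
  refine ⟨?_, n, hn, ?_⟩
  · -- the generator is real, hence so is every element of `ℚ(ζ + ζ⁻¹)`
    have hgen : (starRingEnd ℂ) (ζ + ζ⁻¹) = ζ + ζ⁻¹ := by
      rw [map_add, hinv, Complex.conj_conj, add_comm]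
    exact Complex.conj_eq_iff_im.1 (ringHom_apply_eq_of_mem_adjoin (starRingEnd ℂ) hgen hmem)
  · -- `ζ` is a power of `e^{2πi/n}`
    set ε : ℂ := Complex.exp (2 * Real.pi * Complex.I / n) with hε
    have hprim : IsPrimitiveRoot ε n := Complex.isPrimitiveRoot_exp n hn0
    haveI : NeZero n := ⟨hn0⟩
    obtain ⟨i, -, hi⟩ := hprim.eq_pow_of_pow_eq_one hζ
    have hεmem : ε ∈ IntermediateField.adjoin ℚ ({ε} : Set ℂ) :=
      IntermediateField.mem_adjoin_simple_self ℚ ε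
    have hζmem : ζ ∈ IntermediateField.adjoin ℚ ({ε} : Set ℂ) := by
      rw [← hi]; exact pow_mem hεmem i
    have hgmem : ζ + ζ⁻¹ ∈ IntermediateField.adjoin ℚ ({ε} : Set ℂ) :=
      add_mem hζmem (inv_mem hζmem)
    exact (IntermediateField.adjoin_simple_le_iff.2 hgmem) hmem

end RealAbelian

/-! ### Automorphisms of exponential fields with standard kernel fix the real abelian numbers -/

section Automorphisms

variable {F : Type*} [Field F] [CharZero F] [ExponentialRing F]

omit [CharZero F] in
/-- `exp (n • x) = (exp x)ⁿ`. [folklore] -/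
private theorem exp_nsmul_eq_pow (n : ℕ) (x : F) :
    ExponentialRing.exp (n • x) = ExponentialRing.exp x ^ n := by
  induction n with
  | zero => simp
  | succ n ih => rw [succ_nsmul, ExponentialRing.exp_add, ih, pow_succ]

omit [CharZero F] in
/-- `exp (-x) = (exp x)⁻¹`. [folklore] -/
private theorem exp_neg_eq_inv (x : F) :
    ExponentialRing.exp (-x) = (ExponentialRing.exp x)⁻¹ :=
  (eq_inv_of_mul_eq_one_right (ExponentialRing.exp_mul_exp_neg x))

/-- An automorphism of an exponential field whose kernel is `τℤ`, `τ ≠ 0`, maps `τ` to `τ` or to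
`-τ` (it permutes the two generators of the kernel; KMO §2.1, §3.2: "unique modulo sending `2πi` to
either `τ` or `-τ`"). [cite: KirbyMacintyreOnshuus2012, §2.1 and §3.2] -/
theorem equiv_apply_eq_or_eq_neg_of_expKernel_eq {τ : F}
    (hker : ExponentialRing.expKernel F = AddSubgroup.zmultiples τ) (hτ : τ ≠ 0)
    (σ : ExponentialRingEquiv F F) : σ τ = τ ∨ σ τ = -τ := by
  have hτker : ExponentialRing.exp τ = 1 := by
    rw [← ExponentialRing.mem_expKernel_iff, hker]; exact AddSubgroup.mem_zmultiples τ
  have hmem : ∀ e : ExponentialRingEquiv F F, ∃ k : ℤ, k • τ = e τ := fun e => by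
    rw [← AddSubgroup.mem_zmultiples_iff, ← hker, ExponentialRing.mem_expKernel_iff,
      ← ExponentialRingEquiv.map_exp, hτker, map_one]
  obtain ⟨k, hk⟩ := hmem σ
  obtain ⟨k', hk'⟩ := hmem σ.symm
  have hprod : (k' * k) • τ = τ := by
    conv_rhs => rw [← σ.apply_symm_apply τ, ← hk', map_zsmul, ← hk, smul_smul]
  have hunit : k' * k = 1 := by
    rw [zsmul_eq_mul] at hprod
    have h1 : ((k' * k : ℤ) : F) = 1 := by
      have := mul_right_cancel₀ hτ (hprod.trans (one_mul τ).symm)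
      exact this
    exact_mod_cast h1
  rcases Int.eq_one_or_neg_one_of_mul_eq_one' hunit with ⟨-, rfl⟩ | ⟨-, rfl⟩
  · left; rw [← hk, one_zsmul]
  · right; rw [← hk, neg_one_zsmul]

/-- In an exponential field with kernel `τℤ`, `τ ≠ 0`, and surjective exponential, every root of
unity is `exp (z)` with `nz ∈ τℤ`, so an automorphism `σ` of the exponential field maps each root
of unity `ζ` to `ζ` or to `ζ⁻¹` according as `σ τ = τ` or `σ τ = -τ` (KMO §2.1: the roots of unity
are the `exp (jτ/n)`; the restriction of any such automorphism to `ℚ^{ab}` is `1` or `σ₀`).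
[cite: KirbyMacintyreOnshuus2012, §2.1] -/
theorem equiv_apply_eq_or_eq_inv_of_pow_eq_one {τ : F}
    (hker : ExponentialRing.expKernel F = AddSubgroup.zmultiples τ) (hτ : τ ≠ 0)
    (hsurj : ExponentialRing.IsSurjectiveOntoUnits F) (σ : ExponentialRingEquiv F F)
    {ζ : F} {n : ℕ} (hn : 0 < n) (hζ : ζ ^ n = 1) : σ ζ = ζ ∨ σ ζ = ζ⁻¹ := by
  have hζ0 : ζ ≠ 0 := by
    rintro rfl
    rw [zero_pow hn.ne'] at hζ
    exact zero_ne_one hζ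
  obtain ⟨z, hz⟩ := hsurj ζ hζ0
  -- `n • z` lies in the kernel, `n • z = m • τ`
  have hnz : ∃ m : ℤ, m • τ = n • z := by
    rw [← AddSubgroup.mem_zmultiples_iff, ← hker, ExponentialRing.mem_expKernel_iff,
      exp_nsmul_eq_pow, hz, hζ]
  obtain ⟨m, hm⟩ := hnz
  -- hence `n • σ z = ± n • z` and `σ z = ± z`
  have hcancel : ∀ {a b : F}, n • a = n • b → a = b := fun {a b} h => by
    rw [nsmul_eq_mul, nsmul_eq_mul] at h
    exact mul_left_cancel₀ (Nat.cast_ne_zero.2 hn.ne') h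
  have hσnz : n • σ z = m • σ τ := by rw [← map_nsmul, ← hm, map_zsmul]
  rcases equiv_apply_eq_or_eq_neg_of_expKernel_eq hker hτ σ with h | h
  · left
    have : σ z = z := hcancel (by rw [hσnz, h, hm])
    rw [← hz, ExponentialRingEquiv.map_exp, this]
  · right
    have : σ z = -z := hcancel (by rw [hσnz, h, smul_neg, hm, neg_nsmul])
    rw [← hz, ExponentialRingEquiv.map_exp, this, exp_neg_eq_inv]

/-- **Automorphisms fix the real abelian numbers** (the automorphism-invariance shadow of KMO's
Theorem 1, for exponential fields with standard kernel and surjective exponential): an automorphism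
`σ` of such an exponential field maps every root of unity `ζ` to `ζ^{±1}`, hence fixes `ζ + ζ⁻¹` and
all of `ℚ(ζ + ζ⁻¹)`. This is the easy half of KMO §3.8. [cite: KirbyMacintyreOnshuus2012, §2.1 and §3.8] -/
theorem equiv_apply_eq_of_isRealAbelian (hker : HasStandardKernel F)
    (hsurj : ExponentialRing.IsSurjectiveOntoUnits F) (σ : ExponentialRingEquiv F F) {x : F}
    (hx : IsRealAbelian x) : σ x = x := by
  obtain ⟨τ, hτt, hkerτ⟩ := hker
  have hτ : τ ≠ 0 := fun h => hτt (h ▸ isAlgebraic_zero)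
  obtain ⟨ζ, ⟨n, hn, hζ⟩, hmem⟩ := hx
  have hg : σ (ζ + ζ⁻¹) = ζ + ζ⁻¹ := by
    rcases equiv_apply_eq_or_eq_inv_of_pow_eq_one hkerτ hτ hsurj σ hn hζ with h | h
    · rw [map_add, map_inv₀, h]
    · rw [map_add, map_inv₀, h, inv_inv, add_comm]
  exact ringHom_apply_eq_of_mem_adjoin σ.toRingEquiv.toRingHom hg hmem

/-- In a Zilber field every automorphism of the exponential field fixes every real abelian
number (easy half of KMO §3.8). [cite: KirbyMacintyreOnshuus2012, §3.8] -/
theorem equiv_apply_eq_of_isRealAbelian_of_isZilberField (hF : IsZilberField F)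
    (σ : ExponentialRingEquiv F F) {x : F} (hx : IsRealAbelian x) : σ x = x :=
  equiv_apply_eq_of_isRealAbelian hF.hasStandardKernel hF.isSurjectiveOntoUnits σ hx

end Automorphisms

/-! ### The two named facts (KMO §3.5 Proposition; §3.7) -/

section Facts

/-- **Extending automorphisms** (Kirby–Macintyre–Onshuus 2012, §3.5, Proposition — "the key
structural property of Zilber fields"): *Suppose `F` is a Zilber field with CCP, and `F₀` is a
finitely-generated partial E-subfield of `F` which contains `SK`, such that `F₀ ◁ F`. Then any
automorphism of `F₀` extends to an automorphism of `F`.* (Sketch of proof there: quasiminimal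
excellence of the class of Zilber fields and Kirby, *On quasiminimal excellent classes*, JSL 75
(2010), Thm 3.3; the countable case algebraic over `D(F₀) ∪ E(D(F₀))` is a special case of Kirby,
*Finitely presented exponential fields*.)

Rendering (all notions inline, KMO §3.1–3.2). A *partial exponential subfield* of `F` is a
subfield `F₀` with a `ℚ`-subspace `D = D(F₀) ⊆ F₀` on which `exp` takes values in `F₀` (its
exponential map being `exp|_D`); it *contains `SK`* (`SK = ℚ^{ab}(τ)`, `D(SK) = ℚτ`, `τ` a kernel
generator, identified with its image in `F`, §3.1–3.2) iff `ℚτ ⊆ D`, i.e. `ker exp ⊆ D` (then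
`SK = ℚ(τ, exp ℚτ) ⊆ F₀`); it is *finitely generated* iff for some finite `X`, `X ∩ D` spans `D` and
`F₀` is generated as a field by `X ∪ exp(D)` (§3.1); `F₀ ◁ F` (*strongly embedded*, §3.2) iff
`td(Y, exp Y / F₀) ≥ ldim_ℚ(Y / D)` for every finite `Y ⊆ F` (here: transcendence degree of
`F₀(Y ∪ exp Y)` over `F₀`, and `dim_ℚ` of the image of `span Y` in `F ⧸ D`, which is
`GammaField.ldim D (span Y)` of the tree); an *automorphism* of the partial exponential field `F₀`
is a field automorphism `σ` of `F₀` which is an embedding of partial exponential fields (§3.1: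
`α ∈ D`, `exp α = β` ⟹ `σ α ∈ D`, `exp (σ α) = σ β`) — since `D` is finite dimensional, `σ D = D`
and `σ⁻¹` is again such an embedding, so nothing more need be asked. "Zilber field with CCP" is
the tree's `IsZilberField` (module docstring). The conclusion: an automorphism of the exponential
field `F` (`ExponentialRingEquiv F F`) agreeing with `σ` on `F₀`.
[cite: KirbyMacintyreOnshuus2012, §3.5 Proposition] -/
def KMO2012_automorphismExtension : Prop :=
  ∀ (F : Type u) [Field F] [CharZero F] [ExponentialRing F], IsZilberField F →
    ∀ (F₀ : IntermediateField ℚ F) (D : Submodule ℚ F),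
      -- `(F₀, D, exp|_D)` is a partial exponential subfield of `F` …
      (D : Set F) ⊆ F₀ → (∀ x ∈ D, ExponentialRing.exp x ∈ F₀) →
      -- … containing `SK` (`ker exp ⊆ D`) …
      (∀ x : F, ExponentialRing.exp x = 1 → x ∈ D) →
      -- … finitely generated …
      (∃ X : Finset F, Submodule.span ℚ ((X : Set F) ∩ (D : Set F)) = D ∧
        IntermediateField.adjoin ℚ ((X : Set F) ∪ ExponentialRing.exp '' (D : Set F)) = F₀) →
      -- … and strongly embedded, `F₀ ◁ F`;
      (∀ Y : Finset F,
        (Module.finrank ℚ ↥((Submodule.span ℚ (Y : Set F)).map D.mkQ) : Cardinal) ≤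
          Algebra.trdeg F₀ ↥(IntermediateField.adjoin F₀
            ((Y : Set F) ∪ ExponentialRing.exp '' (Y : Set F)))) →
      -- then every automorphism `σ` of the partial exponential field `F₀` …
      ∀ σ : F₀ ≃+* F₀,
        (∀ x : F₀, (x : F) ∈ D → (σ x : F) ∈ D) →
        (∀ x y : F₀, (x : F) ∈ D → ExponentialRing.exp (x : F) = y →
          ExponentialRing.exp (σ x : F) = σ y) →
        -- … extends to an automorphism of the exponential field `F`.
        ∃ σ' : ExponentialRingEquiv F F, ∀ x : F₀, σ' x = σ x

/-- **Non-real-abelian algebraic numbers are moved by automorphisms of a Zilber field**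
(Kirby–Macintyre–Onshuus 2012, §3.7, the automorphism argument proving Theorem 2 — "For the Zilber
fields, the only pointwise definable algebraic numbers are the real abelian numbers" — for "a
countable Zilber field (or more generally, a Zilber field with CCP)"): if `F` is a Zilber field
with CCP and `α ∈ F` is algebraic over `ℚ` and not real abelian, some automorphism of the
exponential field `F` moves `α`. (Proof there: for `α ∈ ℚ^{ab} ∖ ℚ^{abℝ}` extend, by the §3.5
Proposition, the automorphism `σ₁ : 2πi ↦ -2πi` of `SK ◁ F`, which restricts to `σ₀` on `ℚ^{ab}`;
for `α ∈ ℚ̄ ∖ ℚ^{ab}` extend an automorphism of `SK(α) ◁ F` over `SK` not fixing `α`.) Together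
with the proved converse `equiv_apply_eq_of_isRealAbelian` this is §3.8: "When `F` is a Zilber
field with CCP, … an algebraic number is in `ℚ^{abℝ}` if and only if its orbit under automorphisms
of `F` is a singleton" (`KMO2012_exists_equiv_apply_ne.forall_equiv_apply_eq_iff`).
[cite: KirbyMacintyreOnshuus2012, §3.7 (proof of Theorem 2) and §3.8] -/
def KMO2012_exists_equiv_apply_ne : Prop :=
  ∀ (F : Type u) [Field F] [CharZero F] [ExponentialRing F], IsZilberField F →
    ∀ a : F, IsAlgebraic ℚ a → ¬ IsRealAbelian a → ∃ σ : ExponentialRingEquiv F F, σ a ≠ a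

variable {F : Type u} [Field F] [CharZero F] [ExponentialRing F]

/-- **KMO §3.8 (orbits and definable points), as printed**: in a Zilber field with CCP an
algebraic number is real abelian iff its orbit under automorphisms of the exponential field is a
singleton — from the named fact `KMO2012_exists_equiv_apply_ne` (§3.7) and the proved converse
`equiv_apply_eq_of_isRealAbelian`. [cite: KirbyMacintyreOnshuus2012, §3.8] -/
theorem KMO2012_exists_equiv_apply_ne.forall_equiv_apply_eq_iff
    (h : KMO2012_exists_equiv_apply_ne.{u}) (hF : IsZilberField F) {a : F}
    (ha : IsAlgebraic ℚ a) : (∀ σ : ExponentialRingEquiv F F, σ a = a) ↔ IsRealAbelian a := by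
  refine ⟨fun hall => ?_, fun hra σ => equiv_apply_eq_of_isRealAbelian_of_isZilberField hF σ hra⟩
  by_contra hra
  obtain ⟨σ, hσ⟩ := h F hF a ha hra
  exact hσ (hall σ)

/-- If `α` is algebraic and `α²` is not real abelian, some automorphism of the Zilber field moves
`α` off `{α, -α}` (apply `KMO2012_exists_equiv_apply_ne` to `α²`). This is the form in which the
Schanuel routes consume KMO §3.7–3.8 ("prescribed Galois orbits are realised by automorphisms").
[cite: KirbyMacintyreOnshuus2012, §3.7 and §3.8] -/
theorem KMO2012_exists_equiv_apply_ne.exists_equiv_apply_ne_and_ne_neg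
    (h : KMO2012_exists_equiv_apply_ne.{u}) (hF : IsZilberField F) {a : F}
    (ha : IsAlgebraic ℚ a) (h2 : ¬ IsRealAbelian (a ^ 2)) :
    ∃ σ : ExponentialRingEquiv F F, σ a ≠ a ∧ σ a ≠ -a := by
  obtain ⟨σ, hσ⟩ := h F hF (a ^ 2) (ha.pow 2) h2
  refine ⟨σ, fun h1 => hσ ?_, fun h1 => hσ ?_⟩
  · rw [map_pow, h1]
  · rw [map_pow, h1, neg_sq]

/-- **Zilber's conjecture transfers KMO's orbit theorem to `ℂ_exp`**: if `ℂ_exp` is a Zilber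
field (`IsZilberField ℂ`, i.e. `Literature.NumberTheory.Transcendental.ZilberConjecture`), then
for every algebraic `α ∈ ℂ` whose square is not in `ℚ^{ab} ∩ ℝ` (spelled inline: not both real and
in some `ℚ(e^{2πi/n})`) there is a ring endomorphism `j` of `ℂ` commuting with `exp` — indeed an
automorphism — with `j α ∉ {α, -α}`. From `KMO2012_exists_equiv_apply_ne` and
`IsRealAbelian.complex`. [cite: KirbyMacintyreOnshuus2012, §3.7 and §3.8] -/
theorem KMO2012_exists_equiv_apply_ne.complex (h : KMO2012_exists_equiv_apply_ne.{0})
    (hC : IsZilberField ℂ) {α : ℂ} (hα : IsAlgebraic ℚ α)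
    (h2 : ¬ ((α ^ 2).im = 0 ∧ ∃ n : ℕ, 0 < n ∧
      α ^ 2 ∈ IntermediateField.adjoin ℚ ({Complex.exp (2 * Real.pi * Complex.I / n)} : Set ℂ))) :
    ∃ j : ℂ →+* ℂ, (∀ z : ℂ, j (Complex.exp z) = Complex.exp (j z)) ∧ j α ≠ α ∧ j α ≠ -α := by
  have h2' : ¬ IsRealAbelian (α ^ 2) := fun hra => h2 hra.complex
  obtain ⟨σ, hσ1, hσ2⟩ := h.exists_equiv_apply_ne_and_ne_neg hC hα h2'
  refine ⟨σ.toRingEquiv.toRingHom, fun z => ?_, hσ1, hσ2⟩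
  change σ (ExponentialRing.exp z) = ExponentialRing.exp (σ z)
  exact σ.map_exp z

end Facts

end Literature.ModelTheory.ExponentialFields
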